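import Summits.HubbardSuperconductivity.HubbardSuperconductivity.Theorems.JosephsonMirrorJmInterchangeExactResidues

/-!
# Route `JosephsonMirror` — crux `JmInterchange` (stmt-HubbardSuperconductivity-2227): the SPLIT IMPLICATION, by name
# (crux workfile copy `Cruxes/JmInterchange/SplitD1Glue.lean`; a prover re-homes it verbatim under
# `Theorems/JosephsonMirrorJmInterchangeSplit.lean` in namespace `…Theorems.JosephsonMirror`, `--supports stmt-2227`)

Strategist decomposition D1 of the crux (crux-strategist seat `planner-cstrat-stmt-HubbardSuperconductivity-2227-s1-0`,
2026-08-17; census `Cruxes/JmInterchange/STRATEGY-CENSUS.md`).  The crux `JmInterchange` (uniform linear Josephson gain of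
the window double ⇒ ground-floor pair bridge, universally in `(U, δ)`) is split into its two EXACT single-layer residues
(tree theorem `jmInterchange_iff_reachesFloor_and_bridges`, p127245 — both necessary, jointly sufficient):

* `Sub₁` = (R1) **zero-excess pair order reaches the floor** — at every `U > 0`, `δ ∈ (0, 1/2)`: if for some `c > 0` and
  every `ε > 0`, eventually in even `L`, a unit vector of sector `N_L` or `N_L − 2` (`S^z = 0`) of `hubbardTorus 2 L 1 U`
  lies within `εL²` of its sector floor and has `‖Δ_d v‖² ≥ cL⁴`, then eventually some unit ground state `g` of `(N_L, 0)`
  has `‖Δ_d g‖² ≥ c'L⁴` (the Koma–Tasaki / Lieb–Seiringer–Yngvason converse for the `d`-wave pair field; barrier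
  `Literature/Barriers/HubbardSuperconductivity/SourcedOrderWithoutGroundStateLRO`);
* `Sub₂` = (R2′) **floor order bridges** — at every `(U, δ)`: floor order of `(N_L, 0)` implies the ground-floor pair bridge
  `|⟨χ, Δ_d φ⟩|² ≥ a'L⁴` between `G(N_L, 0)` and `G(N_L − 2, 0)` (exclusion of a tower collision / of non-alternating
  `C₄`-cat parities between the adjacent floors).

`jmInterchange_of_subs : Sub₁ → Sub₂ → JmInterchange` is the curried `.mpr` of p127245 and is the glue of the route edit
`--split JmInterchange --into [JmZepoReachesFloor, JmFloorOrderBridges]`; `subs_of_jmInterchange` re-exports the `.mp`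
direction (the split is lossless).  The hypotheses are spelled with fully qualified names, character for character as the
children are filed, so that the route-file children unfold to them definitionally.

Sources: T. Koma, H. Tasaki, J. Stat. Phys. 76 (1994) 745 (§2.5: only `μ₁ ≥ μ₂` is proved); E. H. Lieb, R. Seiringer,
J. Yngvason, Rep. Math. Phys. 59 (2007) 389 (§3, the open converse); H. Tasaki, J. Stat. Phys. 174 (2019) 735 §5.
Pure logic over a landed theorem; no new definitions.
-/

-- the mandated namespace `Summit.<Summit>.<Problem>.Theorems` repeats `HubbardSuperconductivity`
-- (single-problem summit, D-0017), which the `dupNamespace` linter flags on every declaration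
set_option linter.dupNamespace false

namespace Summit.HubbardSuperconductivity.HubbardSuperconductivity.Cruxes.JmInterchange.SplitD1

open Matrix Literature.MathematicalPhysics.QuantumLattice Filter
open Summit.HubbardSuperconductivity.HubbardSuperconductivity.Theses.JosephsonMirror (JmInterchange)
open Summit.HubbardSuperconductivity.HubbardSuperconductivity.Theorems.JosephsonMirror (jmInterchange_iff_reachesFloor_and_bridges)

/-- **Split implication for the crux `JmInterchange` (strategist D1).**  (R1) "zero-excess `d`-wave pair order reaches the
ground floor at every `(U, δ)`" and (R2′) "floor order is `Δ_d`-connected to the adjacent floor at every `(U, δ)`" together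
give the crux: the curried sufficiency half of `jmInterchange_iff_reachesFloor_and_bridges`.  Koma–Tasaki (1994) §2.5;
Lieb–Seiringer–Yngvason (2007) §3; Tasaki (2019) §5. [folklore] -/
theorem jmInterchange_of_subs
    (h₁ : ∀ (U δ : ℝ), 0 < U → δ ∈ Set.Ioo (0:ℝ) (1 / 2) → (∃ c : ℝ, 0 < c ∧ ∀ ε : ℝ, 0 < ε → ∃ L₀ : ℕ, ∀ (L : ℕ) [NeZero L], Even L → L₀ ≤ L → ∃ n : ℕ, (n = (2 * ⌊(1 - δ) * (L : ℝ) ^ 2 / 2⌋₊) ∨ n = (2 * ⌊(1 - δ) * (L : ℝ) ^ 2 / 2⌋₊) - 2) ∧ ∃ v : Literature.MathematicalPhysics.QuantumLattice.Fock (Literature.MathematicalPhysics.QuantumLattice.Orb (Literature.MathematicalPhysics.QuantumLattice.FermionTorus 2 L)), v ∈ Literature.MathematicalPhysics.QuantumLattice.szSector n 0 ∧ star v ⬝ᵥ v = 1 ∧ (star v ⬝ᵥ (Literature.MathematicalPhysics.QuantumLattice.hubbardTorus 2 L 1 U *ᵥ v)).re ≤ (Literature.MathematicalPhysics.QuantumLattice.hubbardTorus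 2 L 1 U).minEnergyOn (Literature.MathematicalPhysics.QuantumLattice.szSector n 0) + ε * (L : ℝ) ^ 2 ∧ c * (L : ℝ) ^ 4 ≤ (star (Literature.MathematicalPhysics.QuantumLattice.pairField Literature.MathematicalPhysics.QuantumLattice.dWaveFormFactor L *ᵥ v) ⬝ᵥ (Literature.MathematicalPhysics.QuantumLattice.pairField Literature.MathematicalPhysics.QuantumLattice.dWaveFormFactor L *ᵥ v)).re) → ∃ c : ℝ, 0 < c ∧ ∃ L₀ : ℕ, ∀ (L : ℕ) [NeZero L], Even L → L₀ ≤ L → ∃ g : Literature.MathematicalPhysics.QuantumLattice.Fock (Literature.MathematicalPhysics.QuantumLattice.Orb (Literature.MathematicalPhysics.QuantumLattice.FermionTorus 2 L)), Literature.MathematicalPhysics.QuantumLattice.IsGroundStateInSector (Literature.MathematicalPhysics.QuantumLattice.hubbardTorus 2 L 1 U) (2 * ⌊(1 - δ) * (L : ℝ) ^ 2 / 2⌋₊) 0 g ∧ star g ⬝ᵥ g = 1 ∧ c * (L : ℝ) ^ 4 ≤ (star (Literature.MathematicalPhysics.QuantumLattice.pairField Literature.MathematicalPhysics.QuantumLattice.dWaveFormFactor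 L *ᵥ g) ⬝ᵥ (Literature.MathematicalPhysics.QuantumLattice.pairField Literature.MathematicalPhysics.QuantumLattice.dWaveFormFactor L *ᵥ g)).re)
    (h₂ : ∀ (U δ : ℝ), 0 < U → δ ∈ Set.Ioo (0:ℝ) (1 / 2) → (∃ c : ℝ, 0 < c ∧ ∃ L₀ : ℕ, ∀ (L : ℕ) [NeZero L], Even L → L₀ ≤ L → ∃ g : Literature.MathematicalPhysics.QuantumLattice.Fock (Literature.MathematicalPhysics.QuantumLattice.Orb (Literature.MathematicalPhysics.QuantumLattice.FermionTorus 2 L)), Literature.MathematicalPhysics.QuantumLattice.IsGroundStateInSector (Literature.MathematicalPhysics.QuantumLattice.hubbardTorus 2 L 1 U) (2 * ⌊(1 - δ) * (L : ℝ) ^ 2 / 2⌋₊) 0 g ∧ star g ⬝ᵥ g = 1 ∧ c * (L : ℝ) ^ 4 ≤ (star (Literature.MathematicalPhysics.QuantumLattice.pairField Literature.MathematicalPhysics.QuantumLattice.dWaveFormFactor L *ᵥ g) ⬝ᵥ (Literature.MathematicalPhysics.QuantumLattice.pairField Literature.MathematicalPhysics.QuantumLattice.dWaveFormFactor L *ᵥ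 g)).re) → ∃ a' : ℝ, 0 < a' ∧ ∃ L₀ : ℕ, ∀ (L : ℕ) [NeZero L], Even L → L₀ ≤ L → ∃ φ χ : Literature.MathematicalPhysics.QuantumLattice.Fock (Literature.MathematicalPhysics.QuantumLattice.Orb (Literature.MathematicalPhysics.QuantumLattice.FermionTorus 2 L)), Literature.MathematicalPhysics.QuantumLattice.IsGroundStateInSector (Literature.MathematicalPhysics.QuantumLattice.hubbardTorus 2 L 1 U) (2 * ⌊(1 - δ) * (L : ℝ) ^ 2 / 2⌋₊) 0 φ ∧ star φ ⬝ᵥ φ = 1 ∧ Literature.MathematicalPhysics.QuantumLattice.IsGroundStateInSector (Literature.MathematicalPhysics.QuantumLattice.hubbardTorus 2 L 1 U) (2 * ⌊(1 - δ) * (L : ℝ) ^ 2 / 2⌋₊ - 2) 0 χ ∧ star χ ⬝ᵥ χ = 1 ∧ a' * (L : ℝ) ^ 4 ≤ ‖star χ ⬝ᵥ Matrix.mulVec (Literature.MathematicalPhysics.QuantumLattice.pairField Literature.MathematicalPhysics.QuantumLattice.dWaveFormFactor L) φ‖ ^ 2) :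
    JmInterchange :=
  jmInterchange_iff_reachesFloor_and_bridges.mpr ⟨h₁, h₂⟩

/-- **The split is lossless.**  The crux gives back both residues (R1) and (R2′): the necessity half of
`jmInterchange_iff_reachesFloor_and_bridges`, re-exported with the children spelled as filed. [folklore] -/
theorem subs_of_jmInterchange (h : JmInterchange) :
    (∀ (U δ : ℝ), 0 < U → δ ∈ Set.Ioo (0:ℝ) (1 / 2) → (∃ c : ℝ, 0 < c ∧ ∀ ε : ℝ, 0 < ε → ∃ L₀ : ℕ, ∀ (L : ℕ) [NeZero L], Even L → L₀ ≤ L → ∃ n : ℕ, (n = (2 * ⌊(1 - δ) * (L : ℝ) ^ 2 / 2⌋₊) ∨ n = (2 * ⌊(1 - δ) * (L : ℝ) ^ 2 / 2⌋₊) - 2) ∧ ∃ v : Literature.MathematicalPhysics.QuantumLattice.Fock (Literature.MathematicalPhysics.QuantumLattice.Orb (Literature.MathematicalPhysics.QuantumLattice.FermionTorus 2 L)), v ∈ Literature.MathematicalPhysics.QuantumLattice.szSector n 0 ∧ star v ⬝ᵥ v = 1 ∧ (star v ⬝ᵥ (Literature.MathematicalPhysics.QuantumLattice.hubbardTorus 2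 L 1 U *ᵥ v)).re ≤ (Literature.MathematicalPhysics.QuantumLattice.hubbardTorus 2 L 1 U).minEnergyOn (Literature.MathematicalPhysics.QuantumLattice.szSector n 0) + ε * (L : ℝ) ^ 2 ∧ c * (L : ℝ) ^ 4 ≤ (star (Literature.MathematicalPhysics.QuantumLattice.pairField Literature.MathematicalPhysics.QuantumLattice.dWaveFormFactor L *ᵥ v) ⬝ᵥ (Literature.MathematicalPhysics.QuantumLattice.pairField Literature.MathematicalPhysics.QuantumLattice.dWaveFormFactor L *ᵥ v)).re) → ∃ c : ℝ, 0 < c ∧ ∃ L₀ : ℕ, ∀ (L : ℕ) [NeZero L], Even L → L₀ ≤ L → ∃ g : Literature.MathematicalPhysics.QuantumLattice.Fock (Literature.MathematicalPhysics.QuantumLattice.Orb (Literature.MathematicalPhysics.QuantumLattice.FermionTorus 2 L)), Literature.MathematicalPhysics.QuantumLattice.IsGroundStateInSector (Literature.MathematicalPhysics.QuantumLattice.hubbardTorus 2 L 1 U) (2 * ⌊(1 - δ) * (L : ℝ) ^ 2 / 2⌋₊) 0 g ∧ star g ⬝ᵥ g = 1 ∧ c * (L : ℝ) ^ 4 ≤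 (star (Literature.MathematicalPhysics.QuantumLattice.pairField Literature.MathematicalPhysics.QuantumLattice.dWaveFormFactor L *ᵥ g) ⬝ᵥ (Literature.MathematicalPhysics.QuantumLattice.pairField Literature.MathematicalPhysics.QuantumLattice.dWaveFormFactor L *ᵥ g)).re) ∧
    (∀ (U δ : ℝ), 0 < U → δ ∈ Set.Ioo (0:ℝ) (1 / 2) → (∃ c : ℝ, 0 < c ∧ ∃ L₀ : ℕ, ∀ (L : ℕ) [NeZero L], Even L → L₀ ≤ L → ∃ g : Literature.MathematicalPhysics.QuantumLattice.Fock (Literature.MathematicalPhysics.QuantumLattice.Orb (Literature.MathematicalPhysics.QuantumLattice.FermionTorus 2 L)), Literature.MathematicalPhysics.QuantumLattice.IsGroundStateInSector (Literature.MathematicalPhysics.QuantumLattice.hubbardTorus 2 L 1 U) (2 * ⌊(1 - δ) * (L : ℝ) ^ 2 / 2⌋₊) 0 g ∧ star g ⬝ᵥ g = 1 ∧ c * (L : ℝ) ^ 4 ≤ (star (Literature.MathematicalPhysics.QuantumLattice.pairField Literature.MathematicalPhysics.QuantumLattice.dWaveFormFactor L *ᵥ g) ⬝ᵥ (Literature.MathematicalPhysics.QuantumLattice.pairField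 Literature.MathematicalPhysics.QuantumLattice.dWaveFormFactor L *ᵥ g)).re) → ∃ a' : ℝ, 0 < a' ∧ ∃ L₀ : ℕ, ∀ (L : ℕ) [NeZero L], Even L → L₀ ≤ L → ∃ φ χ : Literature.MathematicalPhysics.QuantumLattice.Fock (Literature.MathematicalPhysics.QuantumLattice.Orb (Literature.MathematicalPhysics.QuantumLattice.FermionTorus 2 L)), Literature.MathematicalPhysics.QuantumLattice.IsGroundStateInSector (Literature.MathematicalPhysics.QuantumLattice.hubbardTorus 2 L 1 U) (2 * ⌊(1 - δ) * (L : ℝ) ^ 2 / 2⌋₊) 0 φ ∧ star φ ⬝ᵥ φ = 1 ∧ Literature.MathematicalPhysics.QuantumLattice.IsGroundStateInSector (Literature.MathematicalPhysics.QuantumLattice.hubbardTorus 2 L 1 U) (2 * ⌊(1 - δ) * (L : ℝ) ^ 2 / 2⌋₊ - 2) 0 χ ∧ star χ ⬝ᵥ χ = 1 ∧ a' * (L : ℝ) ^ 4 ≤ ‖star χ ⬝ᵥ Matrix.mulVec (Literature.MathematicalPhysics.QuantumLattice.pairField Literature.MathematicalPhysics.QuantumLattice.dWaveFormFactor L) φ‖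 ^ 2) :=
  jmInterchange_iff_reachesFloor_and_bridges.mp h

end Summit.HubbardSuperconductivity.HubbardSuperconductivity.Cruxes.JmInterchange.SplitD1
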